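import Literature.MathematicalPhysics.QuantumFieldTheory.Balaban1983to89.B9Eq342GradientRowAssembly
import Literature.MathematicalPhysics.QuantumFieldTheory.Balaban1983to89.B9Eq342GradientRowSmallGaugeLetters
import Literature.MathematicalPhysics.QuantumFieldTheory.Balaban1983to89.B9Eq342GreenPrimeTowerSupBoundDecayCosh
import Literature.MathematicalPhysics.QuantumFieldTheory.Balaban1983to89.B9Eq324PenaltyBlockLocal

/-!
# `Balaban1983to89.B9Eq342GreenPrimeTowerGradientRow` — T. Bałaban, *Propagators for lattice gauge theories in a background field*, Commun. Math. Phys.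
# **99** (1985) 389–434 [Balaban1985BackgroundPropagators] Thm 3.1 (3.42) p. 397, SECOND ENTRY — the covariant-gradient row
# `|(∇^η_U G′(U)λ)(x)| ≤ B₀(L^jη)⁻¹e^{−δ₀d(y,y′)}|λ|` for `x ∈ Δ(y)`, `supp λ ⊂ Δ(y′)` — **FOR PRINT's `k`-LEVEL SITE PROPAGATOR `G′_k(U) = (Δ′_{a′,k}(U))⁻¹`
# (`B9Eq324DeltaPrimeATower.GpOfUk`) ON THE TOWER's FINE TORUS `T_{(L^{n+1}m)}`, IN THE CELL's SMALL-GAUGE MODEL: given the DECAYED VALUE ROW of `u = G′_k(U)f`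
# (the first entry of (3.42), this lineage's `B9Eq342GreenPrimeTowerSupBoundDecay`), the model letters `‖U(b) − 1‖ ≤ ε_U`, `‖U(x,μ) − U(x−e_μ,μ)‖ ≤ a_U` and
# the t-free currency windows, `‖(∇^η_U G′_k(U)f)(b)‖ ≤ 2e^{a(L^{n+1}−1)}·(…)·F·e^{−κ·d_m(Πb₊, v)}` at EVERY fine bond `b`, with every letter displayed** — the
# gradient row CONSUMES the value row; ne9-leaf-05's storey-J engine (K41) `B9Eq342GradientRowAssembly` §5 instantiated at the tower

statement-level skeleton of published theorems with citation tags; proofs where landed; nothing here is a claim about the Yang–Mills mass gap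

CITATION HEADER (lean-in-tree rule).  Audit cell `pub-balaban`, sub-cell `t4`, BINDER row NE9; filed by the NE9 OWNER lineage `b2b-balaban-t4-ne9-p1` (gen 95).
SOURCE READ first-hand in the held text layer [Balaban1985BackgroundPropagators] (`paper:balaban1985-cmp99-background-propagators`, journal page = PDF page + 388):
p. 396 (3.35) *«for a configuration U there exists a gauge transformation u on □ such that U^u = e^{iηA}, and if the index of □ is j, then |A| < O(1)Mα₀(L^jη)⁻¹,
|∇^ηA| < O(1)Mα₀(L^jη)⁻² on □»*; p. 397 Thm 3.1 *«There exist positive constants M₁, δ₀, α₀, B₀ dependent on d and L only … such that … for an arbitrary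
configuration U satisfying the regularity condition (3.35) with Mα₀ ≤ α₀ the operator G′(U) (a = 1) satisfies the inequalities»* (3.42) (its second member
`|(∇_UG′(U)λ)(x)|`); p. 398 *«All these inequalities are invariant with respect to gauge transformations of U»* and *«We will prove the above theorem by constructing
a random walk representation similar to that in (2.40)»*.  PRINT's PROOF (the random-walk expansion, Sect. 3 pp. 398–409) is NOT reproduced: the cell's engine for
the gradient row is the contraction in a weighted sup norm of ne9-leaf-05's `B9Eq342GradientRowAssembly` (mathematics: t4-ne9-idea-1 gens 111–145, storey J);
this file is a [folklore] COMPOSITION BY NAME of tree theorems at print's tower operator.  The MODEL (a background small on EVERY bond of the fine torus together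
with the bond-gradient datum — print's (3.35) read in the identity gauge) is the cell's; print's class is cube-local.  Nothing printed is a hypothesis except
the model letters themselves; the `[cite: …]` tags are TEXT LOCATIONS.

WHY THIS FILE (cell context).  The OWNER's plan v11 (`t4/b2b-balaban-t4-ne9-p1/g91/PLAN-V11-STOREY-G1.md`) reaches the sup row of print's `G₁(U)` by Woodbury
around the local part `A₀`; its remainder `A₀⁻¹D_UG′_kQ̃′_k†z` read pointwise needs the covariant GRADIENT of `G′_k(U)g` for block-bounded data `g` AT THE TOWER with
a height-free constant (ne9-leaf-03 g78's located gap (c)(ii), journal l.64493: «STOREY J … assembled at ONE step … NOT at the tower»).  This file is that row for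
`G′_k(U)`, in the currency of the value row of `B9Eq342GreenPrimeTowerSupBoundDecay.norm_GpOfUk_apply_le_decay` (source supported in one big block, output at any
fine bond, decay in the big-block distance `d_m`); its companion `B9Eq342GreenPrimeTowerGradientRowDiagonal` reads every constant on print's diagonal free of the height.

WHAT IS PROVED (sorry-free; proof lane — no `def`; [folklore] composition BY NAME).
* §0 THE TOWER's BLOCK CURRENCY (twin of ne9-leaf-05's (K52) `B9Eq342GradientRowBlockCurrency` on `towerP`, through this lineage's T-B
  `B9Eq342GreenPrimeTowerSupBoundDecayCosh.exp_bigBlockDist_le_weight_site`): **`exp_neg_bigBlockDist_le_weight`** (`e^{−κd_m(Πx,v)} ≤ 2e^{a(L^{n+1}−1)}e^{−κd_m(Πy,v)}W_y(x)`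
  for `0 ≤ κ ≤ aL^{n+1}`), **`weighted_row_of_bigBlock_decay`**, **`weighted_row_of_bigBlock_support`** (a big-block decay bound ∕ a one-big-block support is a
  weighted row relative to EVERY fine centre, the decay in the constant).
* §1 **`norm_covDeriv_GpOfUk_le_blockLetter`** — see its docstring: (K41) §5 `norm_covDeriv_le_weighted_of_letters_penalty` at `N := towerP L m (n+1)`, `t := η⁻¹`,
  `R, S := Ad(U^{±1})`, centre `x₀ := b₊`, comparison gauge `g ≡ 1` and cutoff `χ ≡ 1` by ne9-leaf-05's (K54) `B9Eq342GradientRowSmallGaugeLetters`, the equation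
  `Δ^η_Uu + m_cu + (q − m_cu) = f` from `Δ′_{a′,k}(U)u = f` (`q = (Δ′_{a′,k}(U) − Δ^η_U)u`, the (D-P)k penalty read pointwise on the value row through ne9-leaf-03's
  `B9Eq324PenaltyBlockLocal.norm_block_le_sqrt_mul_tower`), the contraction binder `θ ≤ ½` by (K38) `theta_le`∕`theta_le_half` from the displayed t-free windows.
HONEST SCOPE.  DISPLAYED: the decayed value row of `u` (constant `C_u`, rate `κ` — inhabited by T-A∕T-B∕T-D of this lineage, not here), the (D-P)k letter `p₂`, the
(K1) family `P_y`, (T) contractions, the MODEL letters `U(b) ∈ U1`, `ε_U`, `a_U`, the site rate `a`, the comparison mass `m_c` and (K41)'s currency windows; the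
constant is explicit but crude; whether a background of print's class (3.35) admits the model's global small gauge is the model's matter («WALLED ON A MODEL»);
CONSUMER NOTE (ne9-leaf-03 g78 W-3 (R2)): beta-an4's INTERFACE REQUEST D4 `exists_local_letter_G1k` lists the window letters `hUst hUb hUη hpl` only — the
bond-gradient datum `a_U` is NOT derivable from them (a lattice-scale oscillating pure gauge has `‖U−1‖ ≤ αη`, flat plaquettes and `a_U ≍ αη`), so a `G₁,k` END
built on this row carries ONE more window letter `‖U(x,μ) − U(x−e_μ,μ)‖ ≤ α′η²` unless the consumer's model supplies it;
nothing of [B9] Thm 3.1∕3.3∕3.11 is asserted, valued or discharged.  NOT summit progress (cell pub-balaban: NE9 NOT PRINTED ∕ NOT PROVED; «NE9 ⇐ the named binders»;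
row WALLED ON A MODEL (O-NE9-1; #5 UNRULED); spine PROVED 0∕9; rung (B)+1 on a finite T⁴ — NOT infinite volume, NOT mass gap, NOT BetaPertH, NOT Clay).  HONEST
DEPENDENCY (cell line): continuum YM on T⁴ ⇐ BetaPertH ∧ nine spine estimates (0/9 proved); BetaPertH ⇐ (D1) ∧ (D4) ∧ CAP+tail; G-an2-4 gates asym, D1 and NE2/3/4.
NEW file; nothing modified.  Net new unproved facts: 0.
-/

noncomputable section

set_option autoImplicit false

open scoped BigOperators InnerProductSpace

namespace Literature.MathematicalPhysics.QuantumFieldTheory.Balaban1983to89.B9Eq342GreenPrimeTowerGradientRow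

open B4Sect5Torus (TSite tdist tdist_triangle tdist_self tdist_nonneg)
open B9SectCLatticeCarrier (Bond bpos btgt shift unshift)
open B4TorusKernel.MultiPeriod (circAbs)
open B9Eq311L2Pairing (WL2)
open B11Eq103H1Complex (SiteL2K covLaplaceSiteK covDerivL2K apply_greenK)
open B9Eq310HessianOperator (adTransportW)
open B7Prop1Explicit (U1)
open B9Eq319QprimeTorus (fineP blockCoord)
open B9Eq315QTower (towerP)
open B9Eq316TowerFlatIsOneStep (towerP_eq_fineP_pow siteCast)
open B9Eq324DeltaPrimeATower (laplacePrimeAk GpOfUk)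
open B9Eq328GaugeAction (gaugeU)
open B9Eq331PureGaugeResolventConjugation (adTransportW_inv_adTransportW)
open B9Eq342GradientRowAssembly (norm_covDeriv_le_weighted_of_letters_penalty div_one_sub_le_two_mul)
open B9Eq342GradientRowNaturalPerturbation (theta_le theta_le_half)
open B9Eq342GradientRowSmallGaugeLetters (inner_AdW_one norm_sub_pureGauge_le norm_rel_sub_le norm_inv_sub_le norm_covDiff_le)
open B9Eq342CoshWeightSite (weight_site_pos weight_site_centre)
open B9Eq342GreenPrimeTowerSupBoundDecay (bigBlock_eq_iff)
open B9Eq342GreenPrimeTowerSupBoundDecayCosh (exp_bigBlockDist_le_weight_site)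
open B9Eq324PenaltyBlockLocal (norm_block_le_sqrt_mul_tower)

variable {d : ℕ} (L : ℕ) [NeZero L] (m : Fin d → ℕ) [∀ i, NeZero (m i)] (n : ℕ)

/-! ## §0 The tower's block currency: a big-block decay bound is a weighted row relative to every fine centre -/

/-- **`e^{−κ·d_m(Px, v)} ≤ 2e^{a(L^{n+1}−1)}·e^{−κ·d_m(Py, v)}·W_y(x)` FOR `0 ≤ κ ≤ a·L^{n+1}`** on the tower's fine torus `T_{(L^{n+1}m)}`, `Π` the big-block
map, `W_y` the product-`cosh` site weight of rate `a` centred at `y`: the triangle inequality for `d_m` and the domination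
`B9Eq342GreenPrimeTowerSupBoundDecayCosh.exp_bigBlockDist_le_weight_site` (the tower twin of `B9Eq342GradientRowBlockCurrency.exp_neg_blockDist_le_weight`).
[folklore] [cite: Balaban1985BackgroundPropagators, Thm 3.1 (3.42) p.397, (3.49) p.399] -/
theorem exp_neg_bigBlockDist_le_weight {a κ : ℝ} (ha : 0 ≤ a) (hκ : 0 ≤ κ) (hκa : κ ≤ a * (L : ℝ) ^ (n + 1)) (v : TSite d m)
    (y x : TSite d (towerP L m (n + 1))) :
    Real.exp (-(κ * tdist m (blockCoord (L ^ (n + 1)) m (siteCast (towerP_eq_fineP_pow L m (n + 1)) x)) v)) ≤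
      2 * Real.exp (a * ((L : ℝ) ^ (n + 1) - 1)) *
        Real.exp (-(κ * tdist m (blockCoord (L ^ (n + 1)) m (siteCast (towerP_eq_fineP_pow L m (n + 1)) y)) v)) *
        ∏ μ, Real.cosh (a * (circAbs (towerP L m (n + 1) μ)
          (((((y μ : ℕ) : ZMod (towerP L m (n + 1) μ)) - ((x μ : ℕ) : ZMod (towerP L m (n + 1) μ))).val : ℕ) : ℤ) : ℝ)) := by
  have hm1 : ∀ i, 1 ≤ m i := fun i => Nat.one_le_iff_ne_zero.mpr (NeZero.ne (m i))
  set Py := blockCoord (L ^ (n + 1)) m (siteCast (towerP_eq_fineP_pow L m (n + 1)) y) with hPy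
  set Px := blockCoord (L ^ (n + 1)) m (siteCast (towerP_eq_fineP_pow L m (n + 1)) x) with hPx
  have htri : tdist m Py v ≤ tdist m Py Px + tdist m Px v := tdist_triangle hm1 _ _ _
  have hD : 0 ≤ tdist m Py Px := tdist_nonneg m _ _
  have h1 : Real.exp (-(κ * tdist m Px v)) ≤ Real.exp (-(κ * tdist m Py v)) * Real.exp (a * (L : ℝ) ^ (n + 1) * tdist m Py Px) := by
    rw [← Real.exp_add]
    refine Real.exp_le_exp.mpr ?_
    nlinarith [mul_le_mul_of_nonneg_right hκa hD, mul_le_mul_of_nonneg_left htri hκ]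
  have h2 := exp_bigBlockDist_le_weight_site L m n ha y x
  rw [← hPy, ← hPx] at h2
  have hpos : 0 ≤ Real.exp (-(κ * tdist m Py v)) := (Real.exp_pos _).le
  calc Real.exp (-(κ * tdist m Px v))
      ≤ Real.exp (-(κ * tdist m Py v)) * Real.exp (a * (L : ℝ) ^ (n + 1) * tdist m Py Px) := h1
    _ ≤ Real.exp (-(κ * tdist m Py v)) * (Real.exp (a * ((L : ℝ) ^ (n + 1) - 1)) * 2 * ∏ μ, Real.cosh (a * (circAbs (towerP L m (n + 1) μ)
          (((((y μ : ℕ) : ZMod (towerP L m (n + 1) μ)) - ((x μ : ℕ) : ZMod (towerP L m (n + 1) μ))).val : ℕ) : ℤ) : ℝ))) :=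
        mul_le_mul_of_nonneg_left h2 hpos
    _ = _ := by ring

/-- **(A) A BIG-BLOCK DECAY BOUND IS A WEIGHTED ROW RELATIVE TO EVERY FINE CENTRE**: `‖g(x)‖ ≤ G·e^{−κ·d_m(Px, v)}` for all `x` (`0 ≤ G`, `0 ≤ κ ≤ aL^{n+1}`)
⟹ for every centre `y`: `‖g(x)‖ ≤ (2e^{a(L^{n+1}−1)}·G·e^{−κ·d_m(Py, v)})·W_y(x)` — the value row `N_u` of storey J with the decay in its constant (tower twin
of `B9Eq342GradientRowBlockCurrency.weighted_row_of_block_decay`). [folklore] [cite: Balaban1985BackgroundPropagators, Thm 3.1 (3.42) p.397, (3.49) p.399] -/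
theorem weighted_row_of_bigBlock_decay {E : Type*} [SeminormedAddCommGroup E] (g : TSite d (towerP L m (n + 1)) → E) (v : TSite d m) {a G κ : ℝ}
    (ha : 0 ≤ a) (hG : 0 ≤ G) (hκ : 0 ≤ κ) (hκa : κ ≤ a * (L : ℝ) ^ (n + 1))
    (hg : ∀ x, ‖g x‖ ≤ G * Real.exp (-(κ * tdist m (blockCoord (L ^ (n + 1)) m (siteCast (towerP_eq_fineP_pow L m (n + 1)) x)) v)))
    (y x : TSite d (towerP L m (n + 1))) :
    ‖g x‖ ≤ (2 * Real.exp (a * ((L : ℝ) ^ (n + 1) - 1)) * G *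
        Real.exp (-(κ * tdist m (blockCoord (L ^ (n + 1)) m (siteCast (towerP_eq_fineP_pow L m (n + 1)) y)) v))) *
      (fun x : TSite d (towerP L m (n + 1)) => ∏ μ, Real.cosh (a * (circAbs (towerP L m (n + 1) μ)
          (((((y μ : ℕ) : ZMod (towerP L m (n + 1) μ)) - ((x μ : ℕ) : ZMod (towerP L m (n + 1) μ))).val : ℕ) : ℤ) : ℝ))) x := by
  have h := exp_neg_bigBlockDist_le_weight L m n ha hκ hκa v y x
  calc ‖g x‖ ≤ G * Real.exp (-(κ * tdist m (blockCoord (L ^ (n + 1)) m (siteCast (towerP_eq_fineP_pow L m (n + 1)) x)) v)) := hg x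
    _ ≤ G * (2 * Real.exp (a * ((L : ℝ) ^ (n + 1) - 1)) *
        Real.exp (-(κ * tdist m (blockCoord (L ^ (n + 1)) m (siteCast (towerP_eq_fineP_pow L m (n + 1)) y)) v)) *
        ∏ μ, Real.cosh (a * (circAbs (towerP L m (n + 1) μ)
          (((((y μ : ℕ) : ZMod (towerP L m (n + 1) μ)) - ((x μ : ℕ) : ZMod (towerP L m (n + 1) μ))).val : ℕ) : ℤ) : ℝ))) :=
        mul_le_mul_of_nonneg_left h hG
    _ = _ := by ring

/-- **(B) A FIELD SUPPORTED OVER ONE BIG BLOCK IS A WEIGHTED ROW RELATIVE TO EVERY FINE CENTRE**: `f` vanishing off `Π⁻¹(v)`, `‖f(x)‖ ≤ F` (`0 ≤ F`), any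
displayed rate `0 ≤ κ ≤ aL^{n+1}` ⟹ `‖f(x)‖ ≤ (2e^{a(L^{n+1}−1)}·F·e^{−κ·d_m(Py, v)})·W_y(x)` — the data row `Γ` of storey J (tower twin of
`B9Eq342GradientRowBlockCurrency.weighted_row_of_block_support`). [folklore] [cite: Balaban1985BackgroundPropagators, Thm 3.1 (3.42) p.397 («supp λ ⊂ Δ(y′)»)] -/
theorem weighted_row_of_bigBlock_support {E : Type*} [SeminormedAddCommGroup E] (f : TSite d (towerP L m (n + 1)) → E) (v : TSite d m) {a F κ : ℝ}
    (ha : 0 ≤ a) (hF : 0 ≤ F) (hκ : 0 ≤ κ) (hκa : κ ≤ a * (L : ℝ) ^ (n + 1))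
    (hfv : ∀ x, blockCoord (L ^ (n + 1)) m (siteCast (towerP_eq_fineP_pow L m (n + 1)) x) ≠ v → f x = 0) (hf : ∀ x, ‖f x‖ ≤ F)
    (y x : TSite d (towerP L m (n + 1))) :
    ‖f x‖ ≤ (2 * Real.exp (a * ((L : ℝ) ^ (n + 1) - 1)) * F *
        Real.exp (-(κ * tdist m (blockCoord (L ^ (n + 1)) m (siteCast (towerP_eq_fineP_pow L m (n + 1)) y)) v))) *
      (fun x : TSite d (towerP L m (n + 1)) => ∏ μ, Real.cosh (a * (circAbs (towerP L m (n + 1) μ)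
          (((((y μ : ℕ) : ZMod (towerP L m (n + 1) μ)) - ((x μ : ℕ) : ZMod (towerP L m (n + 1) μ))).val : ℕ) : ℤ) : ℝ))) x := by
  have hm1 : ∀ i, 1 ≤ m i := fun i => Nat.one_le_iff_ne_zero.mpr (NeZero.ne (m i))
  refine weighted_row_of_bigBlock_decay L m n f v ha hF hκ hκa (fun z => ?_) y x
  by_cases hz : blockCoord (L ^ (n + 1)) m (siteCast (towerP_eq_fineP_pow L m (n + 1)) z) = v
  · rw [hz, tdist_self, mul_zero, neg_zero, Real.exp_zero, mul_one]; exact hf z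
  · rw [hfv z hz, norm_zero]; positivity


/-! ## §1 The covariant-gradient row of (3.42) for print's `G′_k(U)` at the tower, small-gauge model, explicit letters -/

section Main

variable {𝔸 : Type*} [NormedRing 𝔸] [NormedAlgebra ℂ 𝔸] [CompleteSpace 𝔸] [NormOneClass 𝔸]
  {W : Type*} [NormedAddCommGroup W] [InnerProductSpace ℂ W] [FiniteDimensional ℂ W] (φ : W ≃ₗ[ℂ] 𝔸) {c₀ : ℝ} [Fact (0 < c₀)]
  {Mφ Mφ' : ℝ} (hφ : ∀ w, ‖φ w‖ ≤ Mφ * ‖w‖) (hφ' : ∀ X, ‖φ.symm X‖ ≤ Mφ' * ‖X‖) (hMφ : 0 ≤ Mφ) (hMφ' : 0 ≤ Mφ')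
  {η : ℝ} (hη : 0 < η) (U : Bond d (towerP L m (n + 1)) → 𝔸ˣ) {c₁ : ℝ} [Fact (0 < c₁)] (a' : ℝ)
  (hpos' : ∀ x : SiteL2K ℂ d (towerP L m (n + 1)) c₀ W, x ≠ 0 → 0 < RCLike.re ⟪x, laplacePrimeAk L m n φ η U a' (c₁ := c₁) x⟫_ℂ)
  (hU1 : ∀ b, U b ∈ U1 𝔸) {εU aU : ℝ} (hεU : 0 ≤ εU) (haU : 0 ≤ aU) (hUε : ∀ b, ‖(U b : 𝔸) - 1‖ ≤ εU)
  (hUa : ∀ (x : TSite d (towerP L m (n + 1))) (μ : Fin d), ‖(U (x, μ) : 𝔸) - (U (unshift μ x, μ) : 𝔸)‖ ≤ aU)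
  (a mc : ℝ) (ha : 0 ≤ a) (hmc : 0 < mc)


include hφ hφ' hMφ hMφ' hη hU1 hεU haU hUε hUa ha hmc in
/-- **THE COVARIANT-GRADIENT ROW OF [B9] (3.42) FOR PRINT's `G′_k(U)` AT `k = n+1` LEVELS, SMALL-GAUGE MODEL, EXPLICIT LETTERS.**  Data: a background `U`
on the tower's fine torus with `U(b) ∈ U1`, `‖U(b) − 1‖ ≤ ε_U` on every bond and the bond-gradient datum `‖U(x,μ) − U(x−e_μ,μ)‖ ≤ a_U` (the MODEL letters);
contractive transporters (T); the (K1) big-block family `P_y` (`Π`-currency) and the (D-P)k block penalty letter `‖((Δ′_{a′,k}(U) − Δ^η_U)w)(x)‖ ≤ p₂‖P_{Πx}w‖`;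
a source `f` supported in the big block `v` with `‖f(x)‖ ≤ F`; THE DECAYED VALUE ROW OF `u = G′_k(U)f` (T-A's output shape, displayed):
`‖u(x)‖ ≤ C_u·F·e^{−κ·d_m(Πx,v)}` with `0 ≤ κ ≤ a·L^{n+1}`; a site rate `a ≥ 0` and a comparison mass `m_c > 2d·η⁻²(cosh a − 1)`; the currency windows of
(K41) §4 in (K37)'s shape (`0 < β ≤ B_ν`, `|η⁻¹|·B_ν ≤ C ≤ K∕√m_c`, `a ≤ κ′`, `2(|η⁻¹|·2M_φM_φ′ε_U)(e^{κ′}+1)dK ≤ √m_c`).  THEN, at every fine bond `b`: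
`‖(∇^η_U G′_k(U)f)(b)‖ ≤ 2e^{a(L^{n+1}−1)}·(2(|η⁻¹|((1 + (p₂√(c₀L^{(n+1)d}) + m_c)C_u) + d·η⁻²(2M_φM_φ′a_U + (2M_φM_φ′ε_U)²)·C_u) + |η⁻¹|·2M_φM_φ′ε_U∕β·C_u)·B_{b.2})·F·e^{−κ·d_m(Πb₊, v)}`
— ne9-leaf-05's (K41) `B9Eq342GradientRowAssembly.norm_covDeriv_le_weighted_of_letters_penalty` on `T_{(L^{n+1}m)}` at `t = η⁻¹`, `R, S = Ad(U^{±1})`, centre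
`x₀ := b₊`, comparison gauge `g ≡ 1` and cutoff `χ ≡ 1` ((K54) `inner_AdW_one`, `norm_sub_pureGauge_le`, `norm_rel_sub_le`, `norm_inv_sub_le`,
`norm_covDiff_le`; `c∕r = c∕r² = 0`, `Ω = univ`), equation `Δ_Uu + m_c u + (q − m_c u) = f` (`q = (Δ′_{a′,k}(U) − Δ^η_U)u`, `Δ′_{a′,k}(U)u = f`), data∕value∕penalty
rows in the weighted currency by §0 and ne9-leaf-03's `norm_block_le_sqrt_mul_tower`, `θ ≤ ½` by (K38) `theta_le`∕`theta_le_half`, `W_{b₊}(b₊) = 1`.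
[cite: Balaban1985BackgroundPropagators, Thm 3.1 (3.42) p.397, (3.23)–(3.25) p.394, (3.35) p.396, (3.43) p.398, (3.49) p.399, (3.70)–(3.73) pp.404–405] -/
theorem norm_covDeriv_GpOfUk_le_blockLetter
    (hlam : 2 * (d : ℝ) * η⁻¹ ^ 2 * (Real.cosh a - 1) < mc) (hn : ∀ ν, 2 ≤ towerP L m (n + 1) ν)
    (hR : ∀ (b : Bond d (towerP L m (n + 1))) (w : W), ‖adTransportW φ U b w‖ ≤ ‖w‖)
    (hS : ∀ (b : Bond d (towerP L m (n + 1))) (w : W), ‖adTransportW φ (fun bb => (U bb)⁻¹) b w‖ ≤ ‖w‖)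
    {PS : TSite d m → SiteL2K ℂ d (towerP L m (n + 1)) c₀ W →L[ℂ] SiteL2K ℂ d (towerP L m (n + 1)) c₀ W}
    (hPS : ∀ (y : TSite d m) (g : SiteL2K ℂ d (towerP L m (n + 1)) c₀ W) (x : TSite d (towerP L m (n + 1))),
      WL2.equiv ℂ (fun _ : TSite d (towerP L m (n + 1)) => c₀) W (PS y g) x =
        if blockCoord (L ^ (n + 1)) m (siteCast (towerP_eq_fineP_pow L m (n + 1)) x) = y then
          WL2.equiv ℂ (fun _ : TSite d (towerP L m (n + 1)) => c₀) W g x else 0)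
    {p₂ : ℝ} (hp₂ : 0 ≤ p₂)
    (hP : ∀ (w : SiteL2K ℂ d (towerP L m (n + 1)) c₀ W) (x : TSite d (towerP L m (n + 1))),
      ‖WL2.equiv ℂ _ W (laplacePrimeAk L m n φ η U a' (c₁ := c₁) w -
        covLaplaceSiteK ((η : ℂ))⁻¹ (adTransportW φ U) (adTransportW φ fun bb => (U bb)⁻¹) w) x‖ ≤
        p₂ * ‖PS (blockCoord (L ^ (n + 1)) m (siteCast (towerP_eq_fineP_pow L m (n + 1)) x)) w‖)
    (v : TSite d m) (f : SiteL2K ℂ d (towerP L m (n + 1)) c₀ W) {F Cu κ : ℝ} (hF : 0 ≤ F) (hCu : 0 ≤ Cu) (hκ : 0 ≤ κ)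
    (hκa : κ ≤ a * (L : ℝ) ^ (n + 1))
    (hfv : ∀ x, blockCoord (L ^ (n + 1)) m (siteCast (towerP_eq_fineP_pow L m (n + 1)) x) ≠ v →
      WL2.equiv ℂ (fun _ : TSite d (towerP L m (n + 1)) => c₀) W f x = 0)
    (hfF : ∀ x, ‖WL2.equiv ℂ (fun _ : TSite d (towerP L m (n + 1)) => c₀) W f x‖ ≤ F)
    (hudec : ∀ x, ‖WL2.equiv ℂ (fun _ : TSite d (towerP L m (n + 1)) => c₀) W (GpOfUk L m n φ η U a' hpos' f) x‖ ≤
      Cu * F * Real.exp (-(κ * tdist m (blockCoord (L ^ (n + 1)) m (siteCast (towerP_eq_fineP_pow L m (n + 1)) x)) v)))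
    {β : ℝ} (hβ : 0 < β) (hβB : ∀ ν, β ≤ (fun ν : Fin d => (1 + Real.exp (-a)) *
    ((1 + 2 * η⁻¹ / (towerP L m (n + 1) ν * Real.sqrt (mc - 2 * ((d : ℝ) - 1) * η⁻¹ ^ 2 * (Real.cosh a - 1)))) /
      Real.sqrt ((mc - 2 * ((d : ℝ) - 1) * η⁻¹ ^ 2 * (Real.cosh a - 1)) ^ 2 + 4 * (mc - 2 * ((d : ℝ) - 1) * η⁻¹ ^ 2 * (Real.cosh a - 1)) * η⁻¹ ^ 2)) +
    2 * Real.sinh a / (mc - 2 * (d : ℝ) * η⁻¹ ^ 2 * (Real.cosh a - 1))) ν)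
    {κ' C K : ℝ} (haκ : a ≤ κ') (hC : 0 ≤ C) (htB : ∀ ν, ‖((η⁻¹ : ℝ) : ℂ)‖ * (fun ν : Fin d => (1 + Real.exp (-a)) *
    ((1 + 2 * η⁻¹ / (towerP L m (n + 1) ν * Real.sqrt (mc - 2 * ((d : ℝ) - 1) * η⁻¹ ^ 2 * (Real.cosh a - 1)))) /
      Real.sqrt ((mc - 2 * ((d : ℝ) - 1) * η⁻¹ ^ 2 * (Real.cosh a - 1)) ^ 2 + 4 * (mc - 2 * ((d : ℝ) - 1) * η⁻¹ ^ 2 * (Real.cosh a - 1)) * η⁻¹ ^ 2)) +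
    2 * Real.sinh a / (mc - 2 * (d : ℝ) * η⁻¹ ^ 2 * (Real.cosh a - 1))) ν ≤ C) (hCK : C ≤ K / Real.sqrt mc)
    (hmK : 2 * ((|η⁻¹| * (2 * Mφ * Mφ' * εU)) * (Real.exp κ' + 1) * (d : ℝ) * K) ≤ Real.sqrt mc)
    (bnd : Bond d (towerP L m (n + 1))) :
    ‖WL2.equiv ℂ (fun _ : Bond d (towerP L m (n + 1)) => c₀) W
        (covDerivL2K ℂ c₀ ((η : ℂ))⁻¹ (adTransportW φ U) (GpOfUk L m n φ η U a' hpos' f)) bnd‖ ≤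
      2 * Real.exp (a * ((L : ℝ) ^ (n + 1) - 1)) *
        (2 * (‖((η⁻¹ : ℝ) : ℂ)‖ * ((1 + (p₂ * Real.sqrt (c₀ * ((L : ℝ) ^ (n + 1)) ^ d) + ‖((mc : ℝ) : ℂ)‖) * Cu) +
              (d : ℝ) * (η⁻¹ ^ 2 * (2 * Mφ * Mφ' * aU + (2 * Mφ * Mφ' * εU) * (2 * Mφ * Mφ' * εU))) * Cu) +
            |η⁻¹| * (2 * Mφ * Mφ' * εU) / β * Cu) * (fun ν : Fin d => (1 + Real.exp (-a)) *
    ((1 + 2 * η⁻¹ / (towerP L m (n + 1) ν * Real.sqrt (mc - 2 * ((d : ℝ) - 1) * η⁻¹ ^ 2 * (Real.cosh a - 1)))) /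
      Real.sqrt ((mc - 2 * ((d : ℝ) - 1) * η⁻¹ ^ 2 * (Real.cosh a - 1)) ^ 2 + 4 * (mc - 2 * ((d : ℝ) - 1) * η⁻¹ ^ 2 * (Real.cosh a - 1)) * η⁻¹ ^ 2)) +
    2 * Real.sinh a / (mc - 2 * (d : ℝ) * η⁻¹ ^ 2 * (Real.cosh a - 1))) bnd.2) *
        F * Real.exp (-(κ * tdist m (blockCoord (L ^ (n + 1)) m (siteCast (towerP_eq_fineP_pow L m (n + 1)) (btgt bnd))) v)) := by
  have hm1 : ∀ i, 1 ≤ m i := fun i => Nat.one_le_iff_ne_zero.mpr (NeZero.ne (m i))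
  have ht : (0 : ℝ) < η⁻¹ := inv_pos.mpr hη
  have hcast : ((η : ℂ))⁻¹ = ((η⁻¹ : ℝ) : ℂ) := (Complex.ofReal_inv η).symm
  -- the solution, the penalty term and the equation in (K41) §5's shape
  set u : SiteL2K ℂ d (towerP L m (n + 1)) c₀ W := GpOfUk L m n φ η U a' hpos' f with hu_def
  set q : SiteL2K ℂ d (towerP L m (n + 1)) c₀ W := laplacePrimeAk L m n φ η U a' (c₁ := c₁) u -
    covLaplaceSiteK ((η : ℂ))⁻¹ (adTransportW φ U) (adTransportW φ fun bb => (U bb)⁻¹) u with hq_def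
  have hsol : laplacePrimeAk L m n φ η U a' (c₁ := c₁) u = f := by rw [hu_def]; exact apply_greenK hpos' f
  have hEq : covLaplaceSiteK ((η⁻¹ : ℝ) : ℂ) (adTransportW φ U) (adTransportW φ fun bb => (U bb)⁻¹) u + ((mc : ℝ) : ℂ) • u +
      (q - ((mc : ℝ) : ℂ) • u) = f := by
    rw [← hcast, hq_def, hsol]; abel
  -- the centre `x₀ := b₊`; the common factor `M′ = 2e^{a(L^{n+1}−1)}`, `E = e^{−κ·d_m(Πx₀, v)}`
  have hM'0 : 0 ≤ 2 * Real.exp (a * ((L : ℝ) ^ (n + 1) - 1)) := by positivity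
  have hE0 : 0 ≤ Real.exp (-(κ * tdist m ((fun x : TSite d (towerP L m (n + 1)) => blockCoord (L ^ (n + 1)) m (siteCast (towerP_eq_fineP_pow L m (n + 1)) x)) (btgt bnd)) v)) := (Real.exp_pos _).le
  -- (DATA) the source row `Γ`
  have hh : ∀ y, ‖WL2.equiv ℂ (fun _ : TSite d (towerP L m (n + 1)) => c₀) W f y‖ ≤
      (2 * Real.exp (a * ((L : ℝ) ^ (n + 1) - 1)) * F * Real.exp (-(κ * tdist m ((fun x : TSite d (towerP L m (n + 1)) => blockCoord (L ^ (n + 1)) m (siteCast (towerP_eq_fineP_pow L m (n + 1)) x)) (btgt bnd)) v))) * (fun x : TSite d (towerP L m (n + 1)) => ∏ μ, Real.cosh (a * (circAbs (towerP L m (n + 1) μ)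
  (ZMod.val (((btgt bnd μ : ℕ) : ZMod (towerP L m (n + 1) μ)) - ((x μ : ℕ) : ZMod (towerP L m (n + 1) μ)))) : ℝ))) y :=
    fun y => weighted_row_of_bigBlock_support L m n (fun x => WL2.equiv ℂ (fun _ : TSite d (towerP L m (n + 1)) => c₀) W f x) v
      ha hF hκ hκa hfv hfF (btgt bnd) y
  -- (VALUE) the decayed value row `N_u`
  have hval : ∀ y, ‖WL2.equiv ℂ (fun _ : TSite d (towerP L m (n + 1)) => c₀) W u y‖ ≤
      (2 * Real.exp (a * ((L : ℝ) ^ (n + 1) - 1)) * (Cu * F) * Real.exp (-(κ * tdist m ((fun x : TSite d (towerP L m (n + 1)) => blockCoord (L ^ (n + 1)) m (siteCast (towerP_eq_fineP_pow L m (n + 1)) x)) (btgt bnd)) v))) * (fun x : TSite d (towerP L m (n + 1)) => ∏ μ, Real.cosh (a * (circAbs (towerP L m (n + 1) μ)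
  (ZMod.val (((btgt bnd μ : ℕ) : ZMod (towerP L m (n + 1) μ)) - ((x μ : ℕ) : ZMod (towerP L m (n + 1) μ)))) : ℝ))) y :=
    fun y => weighted_row_of_bigBlock_decay L m n (fun x => WL2.equiv ℂ (fun _ : TSite d (towerP L m (n + 1)) => c₀) W u x) v
      ha (mul_nonneg hCu hF) hκ hκa hudec (btgt bnd) y
  -- (PENALTY) the block penalty letter read pointwise on the decayed value row, then the order-zero term `q − m_c u`
  have hPS' : ∀ (y : TSite d m) (g : SiteL2K ℂ d (towerP L m (n + 1)) c₀ W) (x : TSite d (towerP L m (n + 1))),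
      WL2.equiv ℂ (fun _ : TSite d (towerP L m (n + 1)) => c₀) W (PS y g) x =
        if (∀ i, (x i : ℕ) / L ^ (n + 1) = (y i : ℕ)) then WL2.equiv ℂ (fun _ : TSite d (towerP L m (n + 1)) => c₀) W g x else 0 :=
    fun y g x => by rw [hPS]; exact if_congr (bigBlock_eq_iff L m n x y) rfl rfl
  have hq : ∀ y, ‖WL2.equiv ℂ (fun _ : TSite d (towerP L m (n + 1)) => c₀) W q y‖ ≤
      (p₂ * Real.sqrt (c₀ * ((L : ℝ) ^ (n + 1)) ^ d) * Cu * F) * Real.exp (-(κ * tdist m ((fun x : TSite d (towerP L m (n + 1)) => blockCoord (L ^ (n + 1)) m (siteCast (towerP_eq_fineP_pow L m (n + 1)) x)) y) v)) := by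
    intro y
    have hfib : ∀ x : TSite d (towerP L m (n + 1)), (∀ i, (x i : ℕ) / L ^ (n + 1) = (((fun x : TSite d (towerP L m (n + 1)) => blockCoord (L ^ (n + 1)) m (siteCast (towerP_eq_fineP_pow L m (n + 1)) x)) y) i : ℕ)) →
        ‖WL2.equiv ℂ (fun _ : TSite d (towerP L m (n + 1)) => c₀) W u x‖ ≤ Cu * F * Real.exp (-(κ * tdist m ((fun x : TSite d (towerP L m (n + 1)) => blockCoord (L ^ (n + 1)) m (siteCast (towerP_eq_fineP_pow L m (n + 1)) x)) y) v)) := by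
      intro x hx
      have hxy : (fun x : TSite d (towerP L m (n + 1)) => blockCoord (L ^ (n + 1)) m (siteCast (towerP_eq_fineP_pow L m (n + 1)) x)) x = (fun x : TSite d (towerP L m (n + 1)) => blockCoord (L ^ (n + 1)) m (siteCast (towerP_eq_fineP_pow L m (n + 1)) x)) y := (bigBlock_eq_iff L m n x ((fun x : TSite d (towerP L m (n + 1)) => blockCoord (L ^ (n + 1)) m (siteCast (towerP_eq_fineP_pow L m (n + 1)) x)) y)).mpr hx
      have h := hudec x
      simp only [] at hxy h ⊢
      rwa [hxy] at h
    have hblk := norm_block_le_sqrt_mul_tower L m n hPS' ((fun x : TSite d (towerP L m (n + 1)) => blockCoord (L ^ (n + 1)) m (siteCast (towerP_eq_fineP_pow L m (n + 1)) x)) y) u (by positivity) hfib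
    calc ‖WL2.equiv ℂ (fun _ : TSite d (towerP L m (n + 1)) => c₀) W q y‖ ≤ p₂ * ‖PS ((fun x : TSite d (towerP L m (n + 1)) => blockCoord (L ^ (n + 1)) m (siteCast (towerP_eq_fineP_pow L m (n + 1)) x)) y) u‖ := by rw [hq_def]; exact hP u y
      _ ≤ p₂ * (Real.sqrt (c₀ * ((L : ℝ) ^ (n + 1)) ^ d) * (Cu * F * Real.exp (-(κ * tdist m ((fun x : TSite d (towerP L m (n + 1)) => blockCoord (L ^ (n + 1)) m (siteCast (towerP_eq_fineP_pow L m (n + 1)) x)) y) v)))) :=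
          mul_le_mul_of_nonneg_left hblk hp₂
      _ = _ := by ring
  have hp : ∀ y, ‖WL2.equiv ℂ (fun _ : TSite d (towerP L m (n + 1)) => c₀) W (q - ((mc : ℝ) : ℂ) • u) y‖ ≤
      (2 * Real.exp (a * ((L : ℝ) ^ (n + 1) - 1)) * ((p₂ * Real.sqrt (c₀ * ((L : ℝ) ^ (n + 1)) ^ d) + ‖((mc : ℝ) : ℂ)‖) * Cu * F) *
        Real.exp (-(κ * tdist m ((fun x : TSite d (towerP L m (n + 1)) => blockCoord (L ^ (n + 1)) m (siteCast (towerP_eq_fineP_pow L m (n + 1)) x)) (btgt bnd)) v))) * (fun x : TSite d (towerP L m (n + 1)) => ∏ μ, Real.cosh (a * (circAbs (towerP L m (n + 1) μ)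
  (ZMod.val (((btgt bnd μ : ℕ) : ZMod (towerP L m (n + 1) μ)) - ((x μ : ℕ) : ZMod (towerP L m (n + 1) μ)))) : ℝ))) y := by
    have hrow : ∀ y, ‖WL2.equiv ℂ (fun _ : TSite d (towerP L m (n + 1)) => c₀) W (q - ((mc : ℝ) : ℂ) • u) y‖ ≤
        ((p₂ * Real.sqrt (c₀ * ((L : ℝ) ^ (n + 1)) ^ d) + ‖((mc : ℝ) : ℂ)‖) * Cu * F) * Real.exp (-(κ * tdist m ((fun x : TSite d (towerP L m (n + 1)) => blockCoord (L ^ (n + 1)) m (siteCast (towerP_eq_fineP_pow L m (n + 1)) x)) y) v)) := by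
      intro y
      rw [WL2.equiv_sub, WL2.equiv_smul, Pi.sub_apply, Pi.smul_apply]
      calc _ ≤ ‖WL2.equiv ℂ (fun _ : TSite d (towerP L m (n + 1)) => c₀) W q y‖ + ‖((mc : ℝ) : ℂ) • WL2.equiv ℂ (fun _ : TSite d (towerP L m (n + 1)) => c₀) W u y‖ :=
            norm_sub_le _ _
        _ ≤ (p₂ * Real.sqrt (c₀ * ((L : ℝ) ^ (n + 1)) ^ d) * Cu * F) * Real.exp (-(κ * tdist m ((fun x : TSite d (towerP L m (n + 1)) => blockCoord (L ^ (n + 1)) m (siteCast (towerP_eq_fineP_pow L m (n + 1)) x)) y) v)) +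
              ‖((mc : ℝ) : ℂ)‖ * (Cu * F * Real.exp (-(κ * tdist m ((fun x : TSite d (towerP L m (n + 1)) => blockCoord (L ^ (n + 1)) m (siteCast (towerP_eq_fineP_pow L m (n + 1)) x)) y) v))) := by
            rw [norm_smul]; exact add_le_add (hq y) (mul_le_mul_of_nonneg_left (hudec y) (norm_nonneg _))
        _ = _ := by ring
    exact fun y => weighted_row_of_bigBlock_decay L m n
      (fun x => WL2.equiv ℂ (fun _ : TSite d (towerP L m (n + 1)) => c₀) W (q - ((mc : ℝ) : ℂ) • u) x) v ha (by positivity) hκ hκa hrow (btgt bnd) y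
  -- the contraction binder `θ ≤ ½` from the t-free windows ((K38) §T)
  have hb0 : 0 ≤ 2 * Mφ * Mφ' * εU := by positivity
  have hb'0 : 0 ≤ 2 * Mφ * Mφ' * aU := by positivity
  have hεn : 0 ≤ (0 : ℝ) / 1 + |η⁻¹| * (2 * Mφ * Mφ' * εU) := by positivity
  have htB' : ∀ ν, |η⁻¹| * (fun ν : Fin d => (1 + Real.exp (-a)) *
    ((1 + 2 * η⁻¹ / (towerP L m (n + 1) ν * Real.sqrt (mc - 2 * ((d : ℝ) - 1) * η⁻¹ ^ 2 * (Real.cosh a - 1)))) /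
      Real.sqrt ((mc - 2 * ((d : ℝ) - 1) * η⁻¹ ^ 2 * (Real.cosh a - 1)) ^ 2 + 4 * (mc - 2 * ((d : ℝ) - 1) * η⁻¹ ^ 2 * (Real.cosh a - 1)) * η⁻¹ ^ 2)) +
    2 * Real.sinh a / (mc - 2 * (d : ℝ) * η⁻¹ ^ 2 * (Real.cosh a - 1))) ν ≤ C := fun ν => by have e := htB ν; rwa [Complex.norm_real, Real.norm_eq_abs] at e
  have hγ : 0 ≤ Real.exp a + 1 := by positivity
  have hθle := theta_le (fun ν : Fin d => (1 + Real.exp (-a)) *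
    ((1 + 2 * η⁻¹ / (towerP L m (n + 1) ν * Real.sqrt (mc - 2 * ((d : ℝ) - 1) * η⁻¹ ^ 2 * (Real.cosh a - 1)))) /
      Real.sqrt ((mc - 2 * ((d : ℝ) - 1) * η⁻¹ ^ 2 * (Real.cosh a - 1)) ^ 2 + 4 * (mc - 2 * ((d : ℝ) - 1) * η⁻¹ ^ 2 * (Real.cosh a - 1)) * η⁻¹ ^ 2)) +
    2 * Real.sinh a / (mc - 2 * (d : ℝ) * η⁻¹ ^ 2 * (Real.cosh a - 1))) hεn hγ (Real.exp_le_exp.mpr haκ) hC htB'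
  have hpos : 0 ≤ ((0 : ℝ) / 1 + |η⁻¹| * (2 * Mφ * Mφ' * εU)) * (Real.exp κ' + 1) * (d : ℝ) := by positivity
  have hmK' : 2 * ((((0 : ℝ) / 1 + |η⁻¹| * (2 * Mφ * Mφ' * εU)) * (Real.exp κ' + 1) * (d : ℝ)) * K) ≤ Real.sqrt mc := by
    rwa [zero_div, zero_add]
  have hθhalf' := theta_le_half hθle hpos hmc hCK hmK'
  have hθhalf : ‖((η⁻¹ : ℝ) : ℂ)‖ * (((0 : ℝ) / 1 + |η⁻¹| * (2 * Mφ * Mφ' * εU)) * ((Real.exp a + 1) * ∑ ν, (fun ν : Fin d => (1 + Real.exp (-a)) *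
    ((1 + 2 * η⁻¹ / (towerP L m (n + 1) ν * Real.sqrt (mc - 2 * ((d : ℝ) - 1) * η⁻¹ ^ 2 * (Real.cosh a - 1)))) /
      Real.sqrt ((mc - 2 * ((d : ℝ) - 1) * η⁻¹ ^ 2 * (Real.cosh a - 1)) ^ 2 + 4 * (mc - 2 * ((d : ℝ) - 1) * η⁻¹ ^ 2 * (Real.cosh a - 1)) * η⁻¹ ^ 2)) +
    2 * Real.sinh a / (mc - 2 * (d : ℝ) * η⁻¹ ^ 2 * (Real.cosh a - 1))) ν)) ≤ 1 / 2 := by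
    rw [Complex.norm_real, Real.norm_eq_abs]; exact hθhalf'
  have hθ : ‖((η⁻¹ : ℝ) : ℂ)‖ * (((0 : ℝ) / 1 + |η⁻¹| * (2 * Mφ * Mφ' * εU)) * ((Real.exp a + 1) * ∑ ν, (fun ν : Fin d => (1 + Real.exp (-a)) *
    ((1 + 2 * η⁻¹ / (towerP L m (n + 1) ν * Real.sqrt (mc - 2 * ((d : ℝ) - 1) * η⁻¹ ^ 2 * (Real.cosh a - 1)))) /
      Real.sqrt ((mc - 2 * ((d : ℝ) - 1) * η⁻¹ ^ 2 * (Real.cosh a - 1)) ^ 2 + 4 * (mc - 2 * ((d : ℝ) - 1) * η⁻¹ ^ 2 * (Real.cosh a - 1)) * η⁻¹ ^ 2)) +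
    2 * Real.sinh a / (mc - 2 * (d : ℝ) * η⁻¹ ^ 2 * (Real.cosh a - 1))) ν)) < 1 :=
    hθhalf.trans_lt (by norm_num)
  -- (K41) §5 at the tower, comparison gauge ≡ 1, cutoff ≡ 1
  have hmain := norm_covDeriv_le_weighted_of_letters_penalty φ η⁻¹ mc a hmc (btgt bnd)
    (fun _ : Bond d (towerP L m (n + 1)) => (1 : TSite d (towerP L m (n + 1)) → 𝔸ˣ)) (fun _ x w w' => inner_AdW_one φ x w w')
    ht ha hlam hn (adTransportW φ U) (adTransportW φ fun bb => (U bb)⁻¹) (fun b w => adTransportW_inv_adTransportW φ U b w) hR hS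
    u f (q - ((mc : ℝ) : ℂ) • u) hEq (by positivity) (by positivity) (by positivity) hh hp hval
    (fun (_ : Bond d (towerP L m (n + 1))) (_ : TSite d (towerP L m (n + 1))) => (1 : ℝ)) (fun _ _ => by simp) (fun _ => rfl) (fun _ => rfl)
    (c := 0) (r := 1) (by norm_num) (by norm_num) (fun _ _ _ => by simp) (fun _ _ _ => by simp) (fun _ _ _ => by norm_num)
    (fun _ : Bond d (towerP L m (n + 1)) => (Set.univ : Set (TSite d (towerP L m (n + 1)))))
    (fun _ x hx => absurd (Set.mem_univ x) hx)
    hb0 hb0 hb'0 (fun b₀ w => norm_sub_pureGauge_le φ hφ hφ' hMφ' U hU1 hUε b₀ w)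
    (fun _ x _ μ w => norm_rel_sub_le φ hφ hφ' hMφ' U hU1 hUε (x, μ) w)
    (fun _ x _ μ w => norm_rel_sub_le φ hφ hφ' hMφ' U hU1 hUε (unshift μ x, μ) w)
    (fun _ x _ μ w => norm_inv_sub_le φ hφ hφ' hMφ' U hU1 hUε (unshift μ x, μ) w)
    (fun _ x _ μ w => norm_covDiff_le φ hφ hφ' hMφ hMφ' U hU1 hUa x μ w) hβ hβB hθ bnd
  -- read the output: `1∕(1−θ) ≤ 2`, `W_{b₊}(b₊) = 1`, the common factor `M′·F·E`
  rw [hcast]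
  have hBC : 0 ≤ (fun ν : Fin d => (1 + Real.exp (-a)) *
    ((1 + 2 * η⁻¹ / (towerP L m (n + 1) ν * Real.sqrt (mc - 2 * ((d : ℝ) - 1) * η⁻¹ ^ 2 * (Real.cosh a - 1)))) /
      Real.sqrt ((mc - 2 * ((d : ℝ) - 1) * η⁻¹ ^ 2 * (Real.cosh a - 1)) ^ 2 + 4 * (mc - 2 * ((d : ℝ) - 1) * η⁻¹ ^ 2 * (Real.cosh a - 1)) * η⁻¹ ^ 2)) +
    2 * Real.sinh a / (mc - 2 * (d : ℝ) * η⁻¹ ^ 2 * (Real.cosh a - 1))) bnd.2 := hβ.le.trans (hβB bnd.2)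
  have hcentre : (fun x : TSite d (towerP L m (n + 1)) => ∏ μ, Real.cosh (a * (circAbs (towerP L m (n + 1) μ)
  (ZMod.val (((btgt bnd μ : ℕ) : ZMod (towerP L m (n + 1) μ)) - ((x μ : ℕ) : ZMod (towerP L m (n + 1) μ)))) : ℝ))) (btgt bnd) = 1 := weight_site_centre (towerP L m (n + 1)) a (btgt bnd)
  rw [hcentre, mul_one] at hmain
  have hA : 0 ≤ ‖((η⁻¹ : ℝ) : ℂ)‖ *
        (2 * Real.exp (a * ((L : ℝ) ^ (n + 1) - 1)) * F * Real.exp (-(κ * tdist m ((fun x : TSite d (towerP L m (n + 1)) => blockCoord (L ^ (n + 1)) m (siteCast (towerP_eq_fineP_pow L m (n + 1)) x)) (btgt bnd)) v)) +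
            2 * Real.exp (a * ((L : ℝ) ^ (n + 1) - 1)) * ((p₂ * Real.sqrt (c₀ * ((L : ℝ) ^ (n + 1)) ^ d) + ‖((mc : ℝ) : ℂ)‖) * Cu * F) *
              Real.exp (-(κ * tdist m ((fun x : TSite d (towerP L m (n + 1)) => blockCoord (L ^ (n + 1)) m (siteCast (towerP_eq_fineP_pow L m (n + 1)) x)) (btgt bnd)) v)) +
          ((d : ℝ) * ((0 : ℝ) / 1 ^ 2) + |η⁻¹| * (2 * Mφ * Mφ' * εU) * ((0 : ℝ) / 1) * ((d : ℝ) * (1 + Real.exp a)) +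
              (d : ℝ) * (η⁻¹ ^ 2 * (2 * Mφ * Mφ' * aU + 2 * Mφ * Mφ' * εU * (2 * Mφ * Mφ' * εU)))) *
            (2 * Real.exp (a * ((L : ℝ) ^ (n + 1) - 1)) * (Cu * F) * Real.exp (-(κ * tdist m ((fun x : TSite d (towerP L m (n + 1)) => blockCoord (L ^ (n + 1)) m (siteCast (towerP_eq_fineP_pow L m (n + 1)) x)) (btgt bnd)) v)))) +
      |η⁻¹| * (2 * Mφ * Mφ' * εU) / β *
        (2 * Real.exp (a * ((L : ℝ) ^ (n + 1) - 1)) * (Cu * F) * Real.exp (-(κ * tdist m ((fun x : TSite d (towerP L m (n + 1)) => blockCoord (L ^ (n + 1)) m (siteCast (towerP_eq_fineP_pow L m (n + 1)) x)) (btgt bnd)) v))) := by positivity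
  refine (hmain.trans (mul_le_mul_of_nonneg_right (div_one_sub_le_two_mul hA hθhalf) hBC)).trans (le_of_eq ?_)
  simp only [zero_div, mul_zero, zero_mul, zero_add, add_zero]
  ring

end Main


end Literature.MathematicalPhysics.QuantumFieldTheory.Balaban1983to89.B9Eq342GreenPrimeTowerGradientRow

end
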